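import Summits.KontsevichZagierPeriods.KontsevichZagierPeriods.Theorems.InverseLandauFiveTermCertificateTame
import Summits.KontsevichZagierPeriods.KontsevichZagierPeriods.Theorems.FurushoPentagonSectorToKernelStokesSpanCalibration

/-!
# `FiveTermCertificate` (route InverseLandau): the two parametrised loop certificates

Support file for item `stmt-KontsevichZagierPeriods-13875`. On the cube `[0,1]³` with coordinates
`(t, u, w) = (c₀, c₁, c₂)` the weight-one integrand `gOne(t,w) + gTwo(t,w)` — whose fibre integrals
`∫₀¹ dt` vanish identically in `w` (the `x`-derivative of Abel's five-term identity along the Tate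
homotopy `x ↦ xw`) — is a sum of four Stokes elements `∂ᵢH − H|_{cᵢ=1} + H|_{cᵢ=0}` of tame functions
(`loopH`, `loopG` along `t` and `u`; names as in the glossary of
`InverseLandauFiveTermCertificateKit.lean`, written out in full in the statements), hence its cube representation is a relation of the
Kontsevich–Zagier calculus by the Stokes span calibration
`SectorToKernel.stub_stokesSpanCalibration` (Ayoub's cubical presentation). This is the route's
`DlogLoopRelator` pattern `Ψ = (1 − u)·1 + u·φ(t)` for the two loops `φ₁ = 1 + xw·mOne`,
`φ₂ = 1 + y·mTwo` (`φ_q(0,w) = φ_q(1,w) = 1`), with the homotopy parameter `w` carried along as a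
third cube coordinate.

References: M. Kontsevich, D. Zagier, *Periods* (2001), §1.2 rules (1)–(3); J. Ayoub, *Periods and
the conjectures of Grothendieck and Kontsevich–Zagier* (2014), Def. 10; D. Zagier, *The dilogarithm
function* (2007), Ch. I §2.
-/

noncomputable section

namespace Summit.KontsevichZagierPeriods.InverseLandau.FiveTerm

open Set MeasureTheory
open Literature.NumberTheory.Transcendental
open Literature.NumberTheory.Transcendental.KZ
open Literature.ModelTheory.ExponentialFields (IsSemialgebraic)
open Summit.KontsevichZagierPeriods.FurushoPentagon.SectorToKernel (stub_stokesSpanCalibration)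

/-! ## Partial derivatives along coordinate lines -/

/-- The partial derivative `DH(z)·eᵢ` of a function differentiable at `z` is the derivative at
`s = zᵢ` of `s ↦ H (z with zᵢ ↦ s)`. [folklore] -/
theorem fderiv_apply_single_eq {n : ℕ} {H : (Fin n → ℝ) → ℝ} {z : Fin n → ℝ} (i : Fin n) {D : ℝ}
    (hH : DifferentiableAt ℝ H z)
    (hd : HasDerivAt (fun s : ℝ => H (Function.update z i s)) D (z i)) :
    fderiv ℝ H z (Pi.single i 1) = D := by
  have h1 : HasFDerivAt H (fderiv ℝ H z) (Function.update z i (z i)) := by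
    rw [Function.update_eq_self]; exact hH.hasFDerivAt
  have h2 : HasDerivAt (fun s => H (Function.update z i s)) (fderiv ℝ H z (Pi.single i 1)) (z i) :=
    h1.comp_hasDerivAt (z i) (hasDerivAt_update z i (z i))
  exact h2.unique hd

/-! ## The loop certificates are tame on the cube -/

section Tame

variable {x y : ℝ} (hx : 0 < x) (hy : 0 < y) (hxy : x + y < 1)
include hx hy hxy

/-- `loopH` of the first loop, coordinates `(t, u, w)`, is analytic near the cube. [folklore] -/
theorem an_loopH_one : AnalyticOnNhd ℝ
    (fun c : Fin 3 → ℝ => (x * (((x * (c 2) * y) * ((c 0) * ((c 0) - 1)) / ((1 - x * (c 2)) * ((1 - y) - x * (c 2) * (c 0))))) / (1 + (c 1) * (x * c 2) * (((x * (c 2) * y) * ((c 0) * ((c 0) - 1)) / ((1 - x * (c 2)) * ((1 - y) - x * (c 2) * (c 0)))))))) (KZ.cube 3) := by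
  intro z hz
  obtain ⟨f01, f02, f03, f04, f05, f06, f07, f08, f09, f10, f11, f12, f13, f14, f15, f16, f17, f18,
    f19, f20, f21, f22, f23, f24, f25⟩ := facts hx hy hxy (mem_Icc_of_mem_cube hz 0)
    (mem_Icc_of_mem_cube hz 1) (mem_Icc_of_mem_cube hz 2)
  have f26 := psi_one_pos hx hy hxy (mem_Icc_of_mem_cube hz 0) (mem_Icc_of_mem_cube hz 1)
    (mem_Icc_of_mem_cube hz 2)
  repeat (first
    | with_reducible exact an_const _
    | with_reducible exact an_coord _ _
    | with_reducible apply an_add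
    | with_reducible apply an_sub
    | with_reducible apply an_div
    | with_reducible apply an_mul
    | with_reducible apply an_neg
    | with_reducible apply an_pow
    | with_reducible apply mul_ne_zero_real
    | with_reducible apply pow_ne_zero_real
    | (with_reducible apply ne_of_gt; with_reducible assumption))

/-- `loopG` of the first loop, coordinates `(t, u, w)`, is analytic near the cube. [folklore] -/
theorem an_loopG_one : AnalyticOnNhd ℝ (fun c : Fin 3 → ℝ =>
    ((c 1) * x * ((((x * (c 2) * y) * ((c 0) + (c 0) - 1) * ((1 - x * (c 2)) * ((1 - y) - x * (c 2) * (c 0))) - (x * (c 2) * y) * ((c 0) * ((c 0) - 1)) * ((1 - x * (c 2)) * (-(x * (c 2))))) / ((1 - x * (c 2)) * ((1 - y) - x * (c 2) * (c 0))) ^ 2)) / (1 + (c 1) * (x * c 2) * (((x * (c 2) * y) * ((c 0) * ((c 0) - 1)) / ((1 - x * (c 2)) * ((1 - y) - x * (c 2) * (c 0)))))))) (KZ.cube 3) := by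
  intro z hz
  obtain ⟨f01, f02, f03, f04, f05, f06, f07, f08, f09, f10, f11, f12, f13, f14, f15, f16, f17, f18,
    f19, f20, f21, f22, f23, f24, f25⟩ := facts hx hy hxy (mem_Icc_of_mem_cube hz 0)
    (mem_Icc_of_mem_cube hz 1) (mem_Icc_of_mem_cube hz 2)
  have f26 := psi_one_pos hx hy hxy (mem_Icc_of_mem_cube hz 0) (mem_Icc_of_mem_cube hz 1)
    (mem_Icc_of_mem_cube hz 2)
  repeat (first
    | with_reducible exact an_const _
    | with_reducible exact an_coord _ _
    | with_reducible apply an_add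
    | with_reducible apply an_sub
    | with_reducible apply an_div
    | with_reducible apply an_mul
    | with_reducible apply an_neg
    | with_reducible apply an_pow
    | with_reducible apply mul_ne_zero_real
    | with_reducible apply pow_ne_zero_real
    | (with_reducible apply ne_of_gt; with_reducible assumption))

/-- `loopH` of the second loop, coordinates `(t, u, w)`, is analytic near the cube. [folklore] -/
theorem an_loopH_two : AnalyticOnNhd ℝ (fun c : Fin 3 → ℝ =>
    ((x * y / (1 - x * c 2)) * (((x * (c 2) * y) * ((c 0) * ((c 0) - 1)) / ((1 - y) * ((1 - x * (c 2)) - y * (c 0))))) / (1 + (c 1) * y * (((x * (c 2) * y) * ((c 0) * ((c 0) - 1)) / ((1 - y) * ((1 - x * (c 2)) - y * (c 0)))))))) (KZ.cube 3) := by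
  intro z hz
  obtain ⟨f01, f02, f03, f04, f05, f06, f07, f08, f09, f10, f11, f12, f13, f14, f15, f16, f17, f18,
    f19, f20, f21, f22, f23, f24, f25⟩ := facts hx hy hxy (mem_Icc_of_mem_cube hz 0)
    (mem_Icc_of_mem_cube hz 1) (mem_Icc_of_mem_cube hz 2)
  have f27 := psi_two_pos hx hy hxy (mem_Icc_of_mem_cube hz 0) (mem_Icc_of_mem_cube hz 1)
    (mem_Icc_of_mem_cube hz 2)
  repeat (first
    | with_reducible exact an_const _
    | with_reducible exact an_coord _ _
    | with_reducible apply an_add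
    | with_reducible apply an_sub
    | with_reducible apply an_div
    | with_reducible apply an_mul
    | with_reducible apply an_neg
    | with_reducible apply an_pow
    | with_reducible apply mul_ne_zero_real
    | with_reducible apply pow_ne_zero_real
    | (with_reducible apply ne_of_gt; with_reducible assumption))

/-- `loopG` of the second loop, coordinates `(t, u, w)`, is analytic near the cube. [folklore] -/
theorem an_loopG_two : AnalyticOnNhd ℝ (fun c : Fin 3 → ℝ =>
    ((c 1) * (x * y / (1 - x * c 2)) * ((((x * (c 2) * y) * ((c 0) + (c 0) - 1) * ((1 - y) * ((1 - x * (c 2)) - y * (c 0))) - (x * (c 2) * y) * ((c 0) * ((c 0) - 1)) * ((1 - y) * (-y))) / ((1 - y) * ((1 - x * (c 2)) - y * (c 0))) ^ 2)) / (1 + (c 1) * y * (((x * (c 2) * y) * ((c 0) * ((c 0) - 1)) / ((1 - y) * ((1 - x * (c 2)) - y * (c 0))))))))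
    (KZ.cube 3) := by
  intro z hz
  obtain ⟨f01, f02, f03, f04, f05, f06, f07, f08, f09, f10, f11, f12, f13, f14, f15, f16, f17, f18,
    f19, f20, f21, f22, f23, f24, f25⟩ := facts hx hy hxy (mem_Icc_of_mem_cube hz 0)
    (mem_Icc_of_mem_cube hz 1) (mem_Icc_of_mem_cube hz 2)
  have f27 := psi_two_pos hx hy hxy (mem_Icc_of_mem_cube hz 0) (mem_Icc_of_mem_cube hz 1)
    (mem_Icc_of_mem_cube hz 2)
  repeat (first
    | with_reducible exact an_const _
    | with_reducible exact an_coord _ _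
    | with_reducible apply an_add
    | with_reducible apply an_sub
    | with_reducible apply an_div
    | with_reducible apply an_mul
    | with_reducible apply an_neg
    | with_reducible apply an_pow
    | with_reducible apply mul_ne_zero_real
    | with_reducible apply pow_ne_zero_real
    | (with_reducible apply ne_of_gt; with_reducible assumption))

end Tame

section Semialgebraic

variable {x y : ℝ} (hxa : IsAlgebraic ℚ x) (hya : IsAlgebraic ℚ y)
include hxa hya

/-- `loopH` of the first loop is `ℚ`-semialgebraic on the cube. [Bochnak–Coste–Roy 1998, Prop. 2.2.6] -/
theorem sa_loopH_one : IsSemialgebraicFunOn ℚ (KZ.cube 3)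
    (fun c : Fin 3 → ℝ => (x * (((x * (c 2) * y) * ((c 0) * ((c 0) - 1)) / ((1 - x * (c 2)) * ((1 - y) - x * (c 2) * (c 0))))) / (1 + (c 1) * (x * c 2) * (((x * (c 2) * y) * ((c 0) * ((c 0) - 1)) / ((1 - x * (c 2)) * ((1 - y) - x * (c 2) * (c 0)))))))) := by
  have hC : IsSemialgebraic ℚ (KZ.cube 3) := KZ.isSemialgebraic_cube
  have h1 := sa_one hC
  repeat (first
    | with_reducible exact isSemialgebraicFunOn_apply hC _
    | with_reducible exact isSemialgebraicFunOn_const_of_isAlgebraic hC hxa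
    | with_reducible exact isSemialgebraicFunOn_const_of_isAlgebraic hC hya
    | with_reducible exact h1
    | with_reducible apply IsSemialgebraicFunOn.fun_add
    | with_reducible apply IsSemialgebraicFunOn.fun_sub
    | with_reducible apply sa_div
    | with_reducible apply IsSemialgebraicFunOn.fun_mul
    | with_reducible apply IsSemialgebraicFunOn.fun_neg
    | with_reducible apply IsSemialgebraicFunOn.fun_pow)

/-- `loopG` of the first loop is `ℚ`-semialgebraic on the cube. [Bochnak–Coste–Roy 1998, Prop. 2.2.6] -/
theorem sa_loopG_one : IsSemialgebraicFunOn ℚ (KZ.cube 3) (fun c : Fin 3 → ℝ =>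
    ((c 1) * x * ((((x * (c 2) * y) * ((c 0) + (c 0) - 1) * ((1 - x * (c 2)) * ((1 - y) - x * (c 2) * (c 0))) - (x * (c 2) * y) * ((c 0) * ((c 0) - 1)) * ((1 - x * (c 2)) * (-(x * (c 2))))) / ((1 - x * (c 2)) * ((1 - y) - x * (c 2) * (c 0))) ^ 2)) / (1 + (c 1) * (x * c 2) * (((x * (c 2) * y) * ((c 0) * ((c 0) - 1)) / ((1 - x * (c 2)) * ((1 - y) - x * (c 2) * (c 0)))))))) := by
  have hC : IsSemialgebraic ℚ (KZ.cube 3) := KZ.isSemialgebraic_cube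
  have h1 := sa_one hC
  repeat (first
    | with_reducible exact isSemialgebraicFunOn_apply hC _
    | with_reducible exact isSemialgebraicFunOn_const_of_isAlgebraic hC hxa
    | with_reducible exact isSemialgebraicFunOn_const_of_isAlgebraic hC hya
    | with_reducible exact h1
    | with_reducible apply IsSemialgebraicFunOn.fun_add
    | with_reducible apply IsSemialgebraicFunOn.fun_sub
    | with_reducible apply sa_div
    | with_reducible apply IsSemialgebraicFunOn.fun_mul
    | with_reducible apply IsSemialgebraicFunOn.fun_neg
    | with_reducible apply IsSemialgebraicFunOn.fun_pow)

/-- `loopH` of the second loop is `ℚ`-semialgebraic on the cube. [Bochnak–Coste–Roy 1998, Prop. 2.2.6] -/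
theorem sa_loopH_two : IsSemialgebraicFunOn ℚ (KZ.cube 3) (fun c : Fin 3 → ℝ =>
    ((x * y / (1 - x * c 2)) * (((x * (c 2) * y) * ((c 0) * ((c 0) - 1)) / ((1 - y) * ((1 - x * (c 2)) - y * (c 0))))) / (1 + (c 1) * y * (((x * (c 2) * y) * ((c 0) * ((c 0) - 1)) / ((1 - y) * ((1 - x * (c 2)) - y * (c 0)))))))) := by
  have hC : IsSemialgebraic ℚ (KZ.cube 3) := KZ.isSemialgebraic_cube
  have h1 := sa_one hC
  repeat (first
    | with_reducible exact isSemialgebraicFunOn_apply hC _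
    | with_reducible exact isSemialgebraicFunOn_const_of_isAlgebraic hC hxa
    | with_reducible exact isSemialgebraicFunOn_const_of_isAlgebraic hC hya
    | with_reducible exact h1
    | with_reducible apply IsSemialgebraicFunOn.fun_add
    | with_reducible apply IsSemialgebraicFunOn.fun_sub
    | with_reducible apply sa_div
    | with_reducible apply IsSemialgebraicFunOn.fun_mul
    | with_reducible apply IsSemialgebraicFunOn.fun_neg
    | with_reducible apply IsSemialgebraicFunOn.fun_pow)

/-- `loopG` of the second loop is `ℚ`-semialgebraic on the cube. [Bochnak–Coste–Roy 1998, Prop. 2.2.6] -/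
theorem sa_loopG_two : IsSemialgebraicFunOn ℚ (KZ.cube 3) (fun c : Fin 3 → ℝ =>
    ((c 1) * (x * y / (1 - x * c 2)) * ((((x * (c 2) * y) * ((c 0) + (c 0) - 1) * ((1 - y) * ((1 - x * (c 2)) - y * (c 0))) - (x * (c 2) * y) * ((c 0) * ((c 0) - 1)) * ((1 - y) * (-y))) / ((1 - y) * ((1 - x * (c 2)) - y * (c 0))) ^ 2)) / (1 + (c 1) * y * (((x * (c 2) * y) * ((c 0) * ((c 0) - 1)) / ((1 - y) * ((1 - x * (c 2)) - y * (c 0)))))))) := by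
  have hC : IsSemialgebraic ℚ (KZ.cube 3) := KZ.isSemialgebraic_cube
  have h1 := sa_one hC
  repeat (first
    | with_reducible exact isSemialgebraicFunOn_apply hC _
    | with_reducible exact isSemialgebraicFunOn_const_of_isAlgebraic hC hxa
    | with_reducible exact isSemialgebraicFunOn_const_of_isAlgebraic hC hya
    | with_reducible exact h1
    | with_reducible apply IsSemialgebraicFunOn.fun_add
    | with_reducible apply IsSemialgebraicFunOn.fun_sub
    | with_reducible apply sa_div
    | with_reducible apply IsSemialgebraicFunOn.fun_mul
    | with_reducible apply IsSemialgebraicFunOn.fun_neg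
    | with_reducible apply IsSemialgebraicFunOn.fun_pow)

end Semialgebraic

/-! ## The weight-one cube representation is a relation -/

/-- **The differentiated five-term identity is a KZ relation, uniformly in the homotopy
parameter.** For real algebraic `0 < x, 0 < y, x + y < 1`, the tame cube representation
`[[0,1]³, gOne(c₀,c₂) + gTwo(c₀,c₂)]` lies in `KZ.relations`: its integrand is the sum of the four
Stokes elements of `loopH` (along `t = c₀`) and `−loopG` (along `u = c₁`) for the two loops, by
`∂ᵤ loopG = ∂ₜ loopH` (`hasDerivAt_loopG`, `hasDerivAt_loopH`), the loop conditions
`mOne = mTwo = 0` at `t = 0, 1`, `loopG|_{u=0} = 0`, and `loopG|_{u=1} = κ ∂ₜlog φ` summing to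
`gOne + gTwo` (`gOne_add_gTwo`). [Kontsevich–Zagier 2001, §1.2; Zagier 2007, Ch. I §2] -/
theorem of_weightOne_mem_relations {x y : ℝ} (hxa : IsAlgebraic ℚ x) (hya : IsAlgebraic ℚ y)
    (hx : 0 < x) (hy : 0 < y) (hxy : x + y < 1)
    (hA : AnalyticOnNhd ℝ (fun c : Fin 3 → ℝ => ((x * 1 / ((1 - y) - (x * (c 2) * (c 0)) * 1) + (x * y / (1 - x * (c 2))) * 1 / ((1 - x * (c 2)) - (y * (c 0)) * 1) - x * 1 / (1 - (x * (c 2) * (c 0)) * 1) - (x * y / (1 - x * (c 2))) * 1 / ((1 - x * (c 2)) * (1 - y) - (x * (c 2) * y * (c 0)) * 1))) + ((-(x * 1 / (1 - (x * (c 2)) * 1) * (y / (1 - y * (c 0)))))))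
      (KZ.cube 3))
    (hS : IsSemialgebraicFunOn ℚ (KZ.cube 3)
      (fun c : Fin 3 → ℝ => ((x * 1 / ((1 - y) - (x * (c 2) * (c 0)) * 1) + (x * y / (1 - x * (c 2))) * 1 / ((1 - x * (c 2)) - (y * (c 0)) * 1) - x * 1 / (1 - (x * (c 2) * (c 0)) * 1) - (x * y / (1 - x * (c 2))) * 1 / ((1 - x * (c 2)) * (1 - y) - (x * (c 2) * y * (c 0)) * 1))) + ((-(x * 1 / (1 - (x * (c 2)) * 1) * (y / (1 - y * (c 0)))))))) :
    of (IntegralRep.tameCube _ hA hS) ∈ relations := by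
  -- the four tame functions
  obtain ⟨H0, hH0⟩ : ∃ H : (Fin 3 → ℝ) → ℝ,
      H = fun c => (x * (((x * (c 2) * y) * ((c 0) * ((c 0) - 1)) / ((1 - x * (c 2)) * ((1 - y) - x * (c 2) * (c 0))))) / (1 + (c 1) * (x * c 2) * (((x * (c 2) * y) * ((c 0) * ((c 0) - 1)) / ((1 - x * (c 2)) * ((1 - y) - x * (c 2) * (c 0))))))) := ⟨_, rfl⟩
  obtain ⟨H1, hH1⟩ : ∃ H : (Fin 3 → ℝ) → ℝ,
      H = fun c => -((c 1) * x * ((((x * (c 2) * y) * ((c 0) + (c 0) - 1) * ((1 - x * (c 2)) * ((1 - y) - x * (c 2) * (c 0))) - (x * (c 2) * y) * ((c 0) * ((c 0) - 1)) * ((1 - x * (c 2)) * (-(x * (c 2))))) / ((1 - x * (c 2)) * ((1 - y) - x * (c 2) * (c 0))) ^ 2)) / (1 + (c 1) * (x * c 2) * (((x * (c 2) * y) * ((c 0) * ((c 0) - 1)) / ((1 - x * (c 2)) * ((1 - y) - x * (c 2) * (c 0))))))) :=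
    ⟨_, rfl⟩
  obtain ⟨H2, hH2⟩ : ∃ H : (Fin 3 → ℝ) → ℝ,
      H = fun c => ((x * y / (1 - x * c 2)) * (((x * (c 2) * y) * ((c 0) * ((c 0) - 1)) / ((1 - y) * ((1 - x * (c 2)) - y * (c 0))))) / (1 + (c 1) * y * (((x * (c 2) * y) * ((c 0) * ((c 0) - 1)) / ((1 - y) * ((1 - x * (c 2)) - y * (c 0))))))) := ⟨_, rfl⟩
  obtain ⟨H3, hH3⟩ : ∃ H : (Fin 3 → ℝ) → ℝ,
      H = fun c => -((c 1) * (x * y / (1 - x * c 2)) * ((((x * (c 2) * y) * ((c 0) + (c 0) - 1) * ((1 - y) * ((1 - x * (c 2)) - y * (c 0))) - (x * (c 2) * y) * ((c 0) * ((c 0) - 1)) * ((1 - y) * (-y))) / ((1 - y) * ((1 - x * (c 2)) - y * (c 0))) ^ 2)) / (1 + (c 1) * y * (((x * (c 2) * y) * ((c 0) * ((c 0) - 1)) / ((1 - y) * ((1 - x * (c 2)) - y * (c 0))))))) := ⟨_, rfl⟩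
  have hH0a : AnalyticOnNhd ℝ H0 (KZ.cube 3) := by rw [hH0]; exact an_loopH_one hx hy hxy
  have hH1a : AnalyticOnNhd ℝ H1 (KZ.cube 3) := by
    rw [hH1]; exact fun z hz => an_neg (an_loopG_one hx hy hxy z hz)
  have hH2a : AnalyticOnNhd ℝ H2 (KZ.cube 3) := by rw [hH2]; exact an_loopH_two hx hy hxy
  have hH3a : AnalyticOnNhd ℝ H3 (KZ.cube 3) := by
    rw [hH3]; exact fun z hz => an_neg (an_loopG_two hx hy hxy z hz)
  have hH0s : IsSemialgebraicFunOn ℚ (KZ.cube 3) H0 := by rw [hH0]; exact sa_loopH_one hxa hya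
  have hH1s : IsSemialgebraicFunOn ℚ (KZ.cube 3) H1 := by
    rw [hH1]; exact (sa_loopG_one hxa hya).fun_neg
  have hH2s : IsSemialgebraicFunOn ℚ (KZ.cube 3) H2 := by rw [hH2]; exact sa_loopH_two hxa hya
  have hH3s : IsSemialgebraicFunOn ℚ (KZ.cube 3) H3 := by
    rw [hH3]; exact (sa_loopG_two hxa hya).fun_neg
  refine stub_stokesSpanCalibration 3 _ rfl 4 ![0, 1, 0, 1] ![H0, H1, H2, H3] ?_ ?_
  · intro j
    fin_cases j
    · exact ⟨hH0a, hH0s⟩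
    · exact ⟨hH1a, hH1s⟩
    · exact ⟨hH2a, hH2s⟩
    · exact ⟨hH3a, hH3s⟩
  intro z hz
  obtain ⟨f01, f02, f03, f04, f05, f06, f07, f08, f09, f10, f11, f12, f13, f14, f15, f16, f17, f18,
    f19, f20, f21, f22, f23, f24, f25⟩ := facts hx hy hxy (mem_Icc_of_mem_cube hz 0)
    (mem_Icc_of_mem_cube hz 1) (mem_Icc_of_mem_cube hz 2)
  have f26 := psi_one_pos hx hy hxy (mem_Icc_of_mem_cube hz 0) (mem_Icc_of_mem_cube hz 1)
    (mem_Icc_of_mem_cube hz 2)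
  have f27 := psi_two_pos hx hy hxy (mem_Icc_of_mem_cube hz 0) (mem_Icc_of_mem_cube hz 1)
    (mem_Icc_of_mem_cube hz 2)
  have fin3_ne01 : (0 : Fin 3) ≠ 1 := by decide
  have fin3_ne10 : (1 : Fin 3) ≠ 0 := by decide
  have fin3_ne20 : (2 : Fin 3) ≠ 0 := by decide
  have fin3_ne21 : (2 : Fin 3) ≠ 1 := by decide
  -- the four partial derivatives
  have hm1 := hasDerivAt_mOne x y (z 0) (z 2) (mul_ne_zero_real f03.ne' f04.ne')
  have hm2 := hasDerivAt_mTwo x y (z 0) (z 2) (mul_ne_zero_real f02.ne' f05.ne')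
  have e0 : fderiv ℝ H0 z (Pi.single 0 1) =
      (x * ((((x * (z 2) * y) * ((z 0) + (z 0) - 1) * ((1 - x * (z 2)) * ((1 - y) - x * (z 2) * (z 0))) - (x * (z 2) * y) * ((z 0) * ((z 0) - 1)) * ((1 - x * (z 2)) * (-(x * (z 2))))) / ((1 - x * (z 2)) * ((1 - y) - x * (z 2) * (z 0))) ^ 2)) / (1 + (z 1) * (x * z 2) * (((x * (z 2) * y) * ((z 0) * ((z 0) - 1)) / ((1 - x * (z 2)) * ((1 - y) - x * (z 2) * (z 0)))))) ^ 2) := by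
    refine fderiv_apply_single_eq 0 ((hH0a z hz).differentiableAt) ?_
    rw [hH0]
    simp only [Function.update_self, Function.update_of_ne fin3_ne10, Function.update_of_ne fin3_ne20]
    exact hasDerivAt_loopH x (x * z 2) (z 1) hm1 f26.ne'
  have e1 : fderiv ℝ H1 z (Pi.single 1 1) =
      -(x * ((((x * (z 2) * y) * ((z 0) + (z 0) - 1) * ((1 - x * (z 2)) * ((1 - y) - x * (z 2) * (z 0))) - (x * (z 2) * y) * ((z 0) * ((z 0) - 1)) * ((1 - x * (z 2)) * (-(x * (z 2))))) / ((1 - x * (z 2)) * ((1 - y) - x * (z 2) * (z 0))) ^ 2)) / (1 + (z 1) * (x * z 2) * (((x * (z 2) * y) * ((z 0) * ((z 0) - 1)) / ((1 - x * (z 2)) * ((1 - y) - x * (z 2) * (z 0)))))) ^ 2) := by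
    refine fderiv_apply_single_eq 1 ((hH1a z hz).differentiableAt) ?_
    rw [hH1]
    simp only [Function.update_self, Function.update_of_ne fin3_ne01, Function.update_of_ne fin3_ne21]
    exact (hasDerivAt_loopG x (x * z 2) _ _ (z 1) f26.ne').neg
  have e2 : fderiv ℝ H2 z (Pi.single 0 1) =
      ((x * y / (1 - x * z 2)) * ((((x * (z 2) * y) * ((z 0) + (z 0) - 1) * ((1 - y) * ((1 - x * (z 2)) - y * (z 0))) - (x * (z 2) * y) * ((z 0) * ((z 0) - 1)) * ((1 - y) * (-y))) / ((1 - y) * ((1 - x * (z 2)) - y * (z 0))) ^ 2)) / (1 + (z 1) * y * (((x * (z 2) * y) * ((z 0) * ((z 0) - 1)) / ((1 - y) * ((1 - x * (z 2)) - y * (z 0)))))) ^ 2) := by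
    refine fderiv_apply_single_eq 0 ((hH2a z hz).differentiableAt) ?_
    rw [hH2]
    simp only [Function.update_self, Function.update_of_ne fin3_ne10, Function.update_of_ne fin3_ne20]
    exact hasDerivAt_loopH (x * y / (1 - x * z 2)) y (z 1) hm2 f27.ne'
  have e3 : fderiv ℝ H3 z (Pi.single 1 1) =
      -((x * y / (1 - x * z 2)) * ((((x * (z 2) * y) * ((z 0) + (z 0) - 1) * ((1 - y) * ((1 - x * (z 2)) - y * (z 0))) - (x * (z 2) * y) * ((z 0) * ((z 0) - 1)) * ((1 - y) * (-y))) / ((1 - y) * ((1 - x * (z 2)) - y * (z 0))) ^ 2)) / (1 + (z 1) * y * (((x * (z 2) * y) * ((z 0) * ((z 0) - 1)) / ((1 - y) * ((1 - x * (z 2)) - y * (z 0)))))) ^ 2) := by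
    refine fderiv_apply_single_eq 1 ((hH3a z hz).differentiableAt) ?_
    rw [hH3]
    simp only [Function.update_self, Function.update_of_ne fin3_ne01, Function.update_of_ne fin3_ne21]
    exact (hasDerivAt_loopG (x * y / (1 - x * z 2)) y _ _ (z 1) f27.ne').neg
  simp only [Fin.sum_univ_four, Matrix.cons_val_zero, Matrix.cons_val_one, Matrix.cons_val_two,
    Matrix.cons_val_three, Matrix.head_cons, Matrix.tail_cons, IntegralRep.tameCube_integrand]
  rw [e0, e1, e2, e3, hH0, hH1, hH2, hH3]
  simp only [Function.update_self, Function.update_of_ne fin3_ne10, Function.update_of_ne fin3_ne20,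
    Function.update_of_ne fin3_ne01, Function.update_of_ne fin3_ne21]
  rw [gOne_add_gTwo x y (z 0) (z 2) f03.ne' f02.ne' f04.ne' f05.ne' f06.ne' f08.ne' f07.ne']
  ring

end Summit.KontsevichZagierPeriods.InverseLandau.FiveTerm
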